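import Summits.QuantumFields.YangMills.Theses.ReplicaVarianceTilt
import Literature.MathematicalPhysics.QuantumFieldTheory.Balaban1983to89.T3TiltDescent

/-!
# Route `ReplicaVarianceTilt` (QuantumFields / YangMills; rung-R3 leaf `T3YM3TorusStatement.YM3TorusSU2`) — glue `LeafOfChiSq`
# (support item stmt-QuantumFields-26134), PART 1: ONE CUT-OFF STEP — a chi-square bound at the comparison height gives a
# total-variation-type increment of the unit laws UP TO A CONSTANT, and the constant costs only the large-field masses

WHAT THIS IS NOT: no estimate of Bałaban's is proved — the chi-square bound (crux `HeightChiSqL`, stmt-QuantumFields-26133) and the history tails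
(`HistoryTailL`, stmt-QuantumFields-19936) are HYPOTHESES of the per-step lemma; nothing here bears on the Yang–Mills mass gap; the rung R3
(`YM3TorusSU2`) is a RECORD rung, not the Clay statement, and stays open.  Pure measure theory (width seat `ym-line-sfw-p2-w2` gen 16).

§1 `exists_integral_abs_sub_const_mul_le` — CHI-SQUARE ⇒ L¹ UP TO A CONSTANT: for non-negative integrable `f₀, f₁` with `f₀ = 0 ⇒ f₁ = 0` a.e.,
   `f₁²/f₀` integrable and `(∫ f₁²/f₀)(∫ f₀) ≤ (1 + v)(∫ f₁)²`, there is `c ≥ 0` with `∫ |f₁ − c·f₀| ≤ √v·∫ f₁` (Cauchy–Schwarz in `L²(f₀)` with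
   `c = ∫f₁/∫f₀`, done by the pointwise AM–GM `|y| ≤ ½(s·y²/b + b/s)` and optimisation in `s`).
§2 `abs_integral_sub_le_of_const_close` — THE FOUR-MEASURE LEMMA WITH A CONSTANT: if the good parts satisfy `|∫W dν_g − c·∫W dμ_g| ≤ t` for all
   measurable `|W| ≤ 1`, the full laws `μ_g + μ_b`, `ν_g + ν_b` have mass one and the bad masses are `≤ w, w'`, then `|∫W dν − ∫W dμ| ≤ 2t + 2w + 2w'`
   (testing `W = 1` pins `|c − 1|·μ_g(X) ≤ t + |ν_g(X) − μ_g(X)| ≤ t + w + w'`).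
§3 `abs_integral_unitLaw_succ_sub_le_of_const_close` — the same for the unit laws of runs `K`, `K+1` split along Bałaban's UV-small-history events
   (tree `unitLaw_eq_map_restrict_add`, `real_map_restrict_univ`).
§4 `abs_integral_unitLaw_succ_sub_le_of_chiSq` — ONE STEP OF THE CASCADE: the clause of `HeightChiSqL` at cut-off `K` (a.c. + integrability + the
   chi-square bound `(∫(ρ¹)²/ρ⁰)(∫ρ⁰) ≤ (1 + v_K)(∫ρ¹)²` for the two runs' restricted densities `heightDensity` descended to the comparison lattice
   `(F.P ⌊K/m⌋)₀`, tree `T3TiltDescent.map_descendTo_restrict_eq_withDensity`, `unitA_comp_descendTo`) and the two large-field masses `≤ w_K` give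
   `|∫W dunitLaw(K+1) − ∫W dunitLaw K| ≤ 2√v_K + 4w_K` for every measurable `|W| ≤ 1`.

References: C. King, CMP 102 (1986) 649–677 [King1986] (Thm 3.4, (3.9)–(3.10) p.656: the four-measure device); T. Bałaban, CMP 102 (1985) 255–275
[Balaban1985UV3] ((2) p.256, (41) p.266).
-/

noncomputable section

open MeasureTheory Filter Topology
open Literature.MathematicalPhysics.QuantumFieldTheory.Balaban1983to89
open Literature.MathematicalPhysics.QuantumFieldTheory.Balaban1983to89.Missing
open Literature.MathematicalPhysics.QuantumFieldTheory.Balaban1983to89.T4Continuum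
open Literature.MathematicalPhysics.QuantumFieldTheory.Balaban1983to89.T3ContinuumYM3Torus
open Literature.MathematicalPhysics.QuantumFieldTheory.Balaban1983to89.T3UnitScaleTilt
open Literature.MathematicalPhysics.QuantumFieldTheory.Balaban1983to89.T3UnitLawDensityEML (ℰp measurableE_ℰp)
open Literature.MathematicalPhysics.QuantumFieldTheory.Balaban1983to89.T3TiltDescent

namespace Summit.QuantumFields.YangMills.Theorems.LeafOfChiSq

/-! ## §1 Chi-square ⇒ L¹ up to a constant -/

section ChiSquare

/-- AM–GM pointwise: for `b > 0`, `s > 0` and any real `y`: `y ≤ (s·(y²/b) + b/s)/2`. [folklore] -/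
theorem amgm_pointwise (y : ℝ) {b s : ℝ} (hb : 0 < b) (hs : 0 < s) :
    y ≤ (s * (y ^ 2 / b) + b / s) / 2 := by
  have hb' := hb.ne'
  have hs' := hs.ne'
  rw [le_div_iff₀ (by norm_num : (0 : ℝ) < 2)]
  have h1 : s * (y ^ 2 / b) + b / s = (s ^ 2 * y ^ 2 + b ^ 2) / (b * s) := by
    field_simp
  rw [h1, le_div_iff₀ (by positivity)]
  nlinarith [sq_nonneg (s * y - b)]

/-- If `I ≤ (s·D + A/s)/2` for every `s > 0` (`D ≥ 0`, `A > 0`), then `I ≤ √(D·A)` (optimise at `s = √(A/D)`). [folklore] -/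
theorem le_sqrt_of_forall_amgm {I D A : ℝ} (hD : 0 ≤ D) (hA : 0 < A)
    (h : ∀ s : ℝ, 0 < s → I ≤ (s * D + A / s) / 2) : I ≤ Real.sqrt (D * A) := by
  rcases hD.eq_or_lt with rfl | hDpos
  · have hI : I ≤ 0 := by
      by_contra hI
      have hI : 0 < I := not_le.mp hI
      have h1 := h (A / I) (div_pos hA hI)
      have e : (A / I * 0 + A / (A / I)) / 2 = I / 2 := by
        field_simp
        ring
      rw [e] at h1
      linarith
    simpa using hI
  · obtain ⟨a, ha, rfl⟩ : ∃ a, 0 < a ∧ A = a ^ 2 := ⟨Real.sqrt A, Real.sqrt_pos.mpr hA, (Real.sq_sqrt hA.le).symm⟩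
    obtain ⟨d, hd, rfl⟩ : ∃ d, 0 < d ∧ D = d ^ 2 := ⟨Real.sqrt D, Real.sqrt_pos.mpr hDpos, (Real.sq_sqrt hDpos.le).symm⟩
    have h1 := h (a / d) (div_pos ha hd)
    have e : (a / d * d ^ 2 + a ^ 2 / (a / d)) / 2 = d * a := by
      field_simp
      ring
    rw [e] at h1
    rw [show d ^ 2 * a ^ 2 = (d * a) ^ 2 by ring, Real.sqrt_sq (by positivity)]
    exact h1

/-- **CHI-SQUARE ⇒ L¹ UP TO A CONSTANT**: for non-negative integrable `f₀, f₁` on any measure space with `f₀ = 0 ⇒ f₁ = 0` a.e., `f₁²/f₀`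
integrable and `(∫ f₁²/f₀)(∫ f₀) ≤ (1 + v)(∫ f₁)²` (`v ≥ 0`), there is `c ≥ 0` with `∫ |f₁ − c·f₀| ≤ √v · ∫ f₁` — Cauchy–Schwarz in `L²(f₀)`
at `c = ∫f₁/∫f₀` (`∫ (f₁ − cf₀)²/f₀ = ∫f₁²/f₀ − (∫f₁)²/∫f₀ ≤ v(∫f₁)²/∫f₀`). [cite: King1986, Thm 3.4 (3.9)-(3.10) p.656] -/
theorem exists_integral_abs_sub_const_mul_le {X : Type*} [MeasurableSpace X] (μ : Measure X)
    {f₀ f₁ : X → ℝ} (hf₀0 : ∀ x, 0 ≤ f₀ x) (hf₁0 : ∀ x, 0 ≤ f₁ x)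
    (hf₀i : Integrable f₀ μ) (hf₁i : Integrable f₁ μ)
    (hac : ∀ᵐ x ∂μ, f₀ x = 0 → f₁ x = 0)
    (hgi : Integrable (fun x => f₁ x ^ 2 / f₀ x) μ) {v : ℝ} (hv : 0 ≤ v)
    (hchi : (∫ x, f₁ x ^ 2 / f₀ x ∂μ) * (∫ x, f₀ x ∂μ) ≤ (1 + v) * (∫ x, f₁ x ∂μ) ^ 2) :
    ∃ c : ℝ, 0 ≤ c ∧ ∫ x, |f₁ x - c * f₀ x| ∂μ ≤ Real.sqrt v * ∫ x, f₁ x ∂μ := by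
  set A := ∫ x, f₀ x ∂μ with hA
  set B := ∫ x, f₁ x ∂μ with hB
  set G := ∫ x, f₁ x ^ 2 / f₀ x ∂μ with hG
  have hA0 : 0 ≤ A := integral_nonneg hf₀0
  have hB0 : 0 ≤ B := integral_nonneg hf₁0
  rcases hA0.eq_or_lt with hA00 | hApos
  · -- `∫ f₀ = 0`: `f₀ = 0` a.e., hence `f₁ = 0` a.e.
    have hf₀ae : f₀ =ᵐ[μ] 0 := (integral_eq_zero_iff_of_nonneg (fun x => hf₀0 x) hf₀i).mp hA00.symm
    have hf₁ae : f₁ =ᵐ[μ] 0 := by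
      filter_upwards [hf₀ae, hac] with x h0 h
      exact h h0
    refine ⟨0, le_rfl, ?_⟩
    have h0 : ∫ x, |f₁ x - 0 * f₀ x| ∂μ = 0 := by
      refine integral_eq_zero_of_ae ?_
      filter_upwards [hf₁ae] with x hx
      simp [hx]
    rw [h0]
    exact mul_nonneg (Real.sqrt_nonneg _) hB0
  · -- `∫ f₀ > 0`: `c = ∫f₁/∫f₀`
    set c := B / A with hc
    have hc0 : 0 ≤ c := div_nonneg hB0 hApos.le
    refine ⟨c, hc0, ?_⟩
    have hcA : c * A = B := by rw [hc]; field_simp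
    set D := v * B ^ 2 / A with hD
    have hD0 : 0 ≤ D := by positivity
    -- the quadratic form `∫ (f₁ − c f₀)²/f₀ = G − 2cB + c²A ≤ D`
    have hquad : G - 2 * c * B + c ^ 2 * A ≤ D := by
      refine le_of_mul_le_mul_right ?_ hApos
      have e1 : (G - 2 * c * B + c ^ 2 * A) * A = G * A - 2 * B * (c * A) + (c * A) ^ 2 := by ring
      have e2 : D * A = v * B ^ 2 := by rw [hD]; field_simp
      rw [e1, hcA, e2]
      nlinarith [hchi]
    have hI2 : Integrable (fun x => 2 * c * f₁ x) μ := hf₁i.const_mul _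
    have hI3 : Integrable (fun x => c ^ 2 * f₀ x) μ := hf₀i.const_mul _
    have hI12 : Integrable (fun x => f₁ x ^ 2 / f₀ x - 2 * c * f₁ x) μ := hgi.sub hI2
    have hIlin : ∫ x, (f₁ x ^ 2 / f₀ x - 2 * c * f₁ x + c ^ 2 * f₀ x) ∂μ = G - 2 * c * B + c ^ 2 * A := by
      rw [integral_add hI12 hI3, integral_sub hgi hI2, integral_const_mul, integral_const_mul]
    have hlin : Integrable (fun x => f₁ x ^ 2 / f₀ x - 2 * c * f₁ x + c ^ 2 * f₀ x) μ := hI12.add hI3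
    -- for every `s > 0`: `∫ |f₁ − c f₀| ≤ (s·D + A/s)/2`
    have hs : ∀ s : ℝ, 0 < s → ∫ x, |f₁ x - c * f₀ x| ∂μ ≤ (s * D + A / s) / 2 := by
      intro s hs
      have hpt : ∀ᵐ x ∂μ, |f₁ x - c * f₀ x| ≤
          (s * (f₁ x ^ 2 / f₀ x - 2 * c * f₁ x + c ^ 2 * f₀ x) + f₀ x / s) / 2 := by
        filter_upwards [hac] with x hx
        by_cases h0 : f₀ x = 0
        · have h1 := hx h0
          simp [h0, h1]
        · have hpos : 0 < f₀ x := lt_of_le_of_ne (hf₀0 x) (Ne.symm h0)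
          have h := amgm_pointwise |f₁ x - c * f₀ x| hpos hs
          rw [sq_abs] at h
          have e : (f₁ x - c * f₀ x) ^ 2 / f₀ x = f₁ x ^ 2 / f₀ x - 2 * c * f₁ x + c ^ 2 * f₀ x := by
            field_simp
            ring
          rw [e] at h
          exact h
      have hRi : Integrable (fun x => (s * (f₁ x ^ 2 / f₀ x - 2 * c * f₁ x + c ^ 2 * f₀ x) + f₀ x / s) / 2) μ :=
        ((hlin.const_mul s).add (hf₀i.div_const s)).div_const 2
      have hLi : Integrable (fun x => |f₁ x - c * f₀ x|) μ := (hf₁i.sub (hf₀i.const_mul c)).abs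
      have hint : ∫ x, (s * (f₁ x ^ 2 / f₀ x - 2 * c * f₁ x + c ^ 2 * f₀ x) + f₀ x / s) / 2 ∂μ =
          (s * (G - 2 * c * B + c ^ 2 * A) + A / s) / 2 := by
        rw [integral_div, integral_add (hlin.const_mul s) (hf₀i.div_const s), integral_const_mul, integral_div, hIlin]
      have hsD : s * (G - 2 * c * B + c ^ 2 * A) ≤ s * D := mul_le_mul_of_nonneg_left hquad hs.le
      calc ∫ x, |f₁ x - c * f₀ x| ∂μ
          ≤ ∫ x, (s * (f₁ x ^ 2 / f₀ x - 2 * c * f₁ x + c ^ 2 * f₀ x) + f₀ x / s) / 2 ∂μ := integral_mono_ae hLi hRi hpt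
        _ = (s * (G - 2 * c * B + c ^ 2 * A) + A / s) / 2 := hint
        _ ≤ (s * D + A / s) / 2 := by linarith
    -- optimise in `s`
    have hmain := le_sqrt_of_forall_amgm hD0 hApos hs
    have hDA : D * A = v * B ^ 2 := by rw [hD]; field_simp
    rw [hDA, Real.sqrt_mul hv, Real.sqrt_sq hB0] at hmain
    exact hmain

end ChiSquare

/-! ## §2 The four-measure lemma with a constant -/

section FourMeasures

variable {X : Type*} [MeasurableSpace X]

/-- Bounded measurable observables are integrable against finite measures (local helper). [folklore] -/
theorem integrable_of_abs_le_one {W : X → ℝ} (hWm : Measurable W) (hW1 : ∀ x, |W x| ≤ 1)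
    (κ : Measure X) [IsFiniteMeasure κ] : Integrable W κ :=
  Integrable.of_bound hWm.aestronglyMeasurable 1 (ae_of_all _ fun x => by rw [Real.norm_eq_abs]; exact hW1 x)

/-- `|∫ W dκ| ≤ κ(univ)` for `|W| ≤ 1` (local helper). [folklore] -/
theorem abs_integral_le_real_univ {W : X → ℝ} (hW1 : ∀ x, |W x| ≤ 1) (κ : Measure X) [IsFiniteMeasure κ] :
    |∫ x, W x ∂κ| ≤ κ.real Set.univ := by
  have h1 := norm_integral_le_of_norm_le_const (μ := κ) (C := 1) (f := W)
    (ae_of_all _ fun x => by rw [Real.norm_eq_abs]; exact hW1 x)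
  rwa [Real.norm_eq_abs, one_mul] at h1

/-- **THE FOUR-MEASURE LEMMA WITH A CONSTANT**: if the good parts are close UP TO A CONSTANT `c` (`|∫W dν_g − c·∫W dμ_g| ≤ t` for every
measurable `|W| ≤ 1`), the full laws `μ_g + μ_b`, `ν_g + ν_b` have total mass `1`, and the bad masses are `≤ w, w'`, then the full laws are
`(2t + 2w + 2w')`-close on such `W` — testing `W ≡ 1` gives `|c·μ_g(X) − μ_g(X)| ≤ t + |ν_g(X) − μ_g(X)| ≤ t + w + w'`, which pays for the
constant. [cite: King1986, Thm 3.4 (3.9)-(3.10) p.656] -/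
theorem abs_integral_sub_le_of_const_close {μg μb νg νb : Measure X} [IsFiniteMeasure μg] [IsFiniteMeasure μb]
    [IsFiniteMeasure νg] [IsFiniteMeasure νb] {c t w w' : ℝ}
    (hg : ∀ W : X → ℝ, Measurable W → (∀ x, |W x| ≤ 1) → |(∫ x, W x ∂νg) - c * ∫ x, W x ∂μg| ≤ t)
    (hμ : μg.real Set.univ + μb.real Set.univ = 1) (hν : νg.real Set.univ + νb.real Set.univ = 1)
    (hw : μb.real Set.univ ≤ w) (hw' : νb.real Set.univ ≤ w') {W : X → ℝ} (hWm : Measurable W) (hW1 : ∀ x, |W x| ≤ 1) :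
    |(∫ x, W x ∂(νg + νb)) - ∫ x, W x ∂(μg + μb)| ≤ 2 * t + 2 * w + 2 * w' := by
  rw [integral_add_measure (integrable_of_abs_le_one hWm hW1 _) (integrable_of_abs_le_one hWm hW1 _),
    integral_add_measure (integrable_of_abs_le_one hWm hW1 _) (integrable_of_abs_le_one hWm hW1 _)]
  set m := μg.real Set.univ with hm
  set n := νg.real Set.univ with hn
  have hm0 : 0 ≤ m := measureReal_nonneg
  have hμb0 : 0 ≤ μb.real Set.univ := measureReal_nonneg
  have hνb0 : 0 ≤ νb.real Set.univ := measureReal_nonneg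
  -- testing `W ≡ 1`
  have hone : |n - c * m| ≤ t := by
    have h := hg (fun _ => (1 : ℝ)) measurable_const (fun _ => by simp)
    simpa [integral_const, hm, hn] using h
  -- the constant costs `t + |n − m|`
  have hI : |∫ x, W x ∂μg| ≤ m := abs_integral_le_real_univ hW1 μg
  have hconst : |(c - 1) * ∫ x, W x ∂μg| ≤ t + |n - m| := by
    calc |(c - 1) * ∫ x, W x ∂μg| = |c - 1| * |∫ x, W x ∂μg| := abs_mul _ _
      _ ≤ |c - 1| * m := mul_le_mul_of_nonneg_left hI (abs_nonneg _)
      _ = |c * m - m| := by rw [show c * m - m = (c - 1) * m by ring, abs_mul, abs_of_nonneg hm0]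
      _ ≤ |c * m - n| + |n - m| := abs_sub_le _ _ _
      _ ≤ t + |n - m| := by rw [abs_sub_comm] at hone; exact add_le_add hone le_rfl
  have hnm : |n - m| ≤ w + w' := by
    rw [abs_le]
    constructor <;> linarith
  have hmain : |(∫ x, W x ∂νg) - ∫ x, W x ∂μg| ≤ 2 * t + w + w' := by
    have hsplit : (∫ x, W x ∂νg) - ∫ x, W x ∂μg =
        ((∫ x, W x ∂νg) - c * ∫ x, W x ∂μg) + (c - 1) * ∫ x, W x ∂μg := by ring
    rw [hsplit]
    refine (abs_add_le _ _).trans ?_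
    linarith [hg W hWm hW1, hconst, hnm]
  obtain ⟨a1, a2⟩ := abs_le.mp hmain
  obtain ⟨b1, b2⟩ := abs_le.mp ((abs_integral_le_real_univ hW1 νb).trans hw')
  obtain ⟨c1, c2⟩ := abs_le.mp ((abs_integral_le_real_univ hW1 μb).trans hw)
  exact abs_le.mpr ⟨by linarith, by linarith⟩

end FourMeasures

/-! ## §3 The unit laws of two consecutive runs, split along the UV-small-history events -/

section UnitLaws

/-- **TWO CONSECUTIVE UNIT LAWS FROM GOOD PARTS CLOSE UP TO A CONSTANT** (`γ ≥ 0`, any thresholds `θ`, any number `n` of free top steps): if the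
unit push-forwards of run `K`'s and run `K+1`'s Gibbs measures restricted to the small-history events satisfy `|∫W dν_g − c·∫W dμ_g| ≤ t` and the
complements have masses `≤ w, w'`, then `|∫ W dunitLaw(K+1) − ∫ W dunitLaw K| ≤ 2t + 2w + 2w'` for every measurable `|W| ≤ 1`.
[cite: King1986, Thm 3.4 (3.9)-(3.10) p.656] -/
theorem abs_integral_unitLaw_succ_sub_le_of_const_close (F : T3Family) {γ : ℝ} (hγ : 0 ≤ γ) (θ : ℕ → ℝ) (n K : ℕ)
    {c t w w' : ℝ}
    (hg : ∀ W : GaugeField (F.P 0) 0 (Matrix.specialUnitaryGroup (Fin 2) ℂ) → ℝ, Measurable W → (∀ u, |W u| ≤ 1) →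
      |(∫ u, W u ∂Measure.map (unitA F ℰp (K + 1)) ((gibbsK F ℰp γ (K + 1)).restrict (histGood F ℰp θ (K + 1) n))) -
          c * ∫ u, W u ∂Measure.map (unitA F ℰp K) ((gibbsK F ℰp γ K).restrict (histGood F ℰp θ K n))| ≤ t)
    (hw : (gibbsK F ℰp γ K).real (histGood F ℰp θ K n)ᶜ ≤ w)
    (hw' : (gibbsK F ℰp γ (K + 1)).real (histGood F ℰp θ (K + 1) n)ᶜ ≤ w')
    {W : GaugeField (F.P 0) 0 (Matrix.specialUnitaryGroup (Fin 2) ℂ) → ℝ} (hWm : Measurable W) (hW1 : ∀ u, |W u| ≤ 1) :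
    |(∫ u, W u ∂F.unitLaw ℰp measurableE_ℰp γ (K + 1)) - ∫ u, W u ∂F.unitLaw ℰp measurableE_ℰp γ K| ≤
      2 * t + 2 * w + 2 * w' := by
  haveI := isProbabilityMeasure_gibbsK F ℰp hγ K
  haveI := isProbabilityMeasure_gibbsK F ℰp hγ (K + 1)
  have hS₀ : MeasurableSet (histGood F ℰp θ K n) := measurableSet_histGood F ℰp measurableE_ℰp θ K n
  have hS₁ : MeasurableSet (histGood F ℰp θ (K + 1) n) := measurableSet_histGood F ℰp measurableE_ℰp θ (K + 1) n
  rw [unitLaw_eq_map_restrict_add measurableE_ℰp (K + 1) hS₁, unitLaw_eq_map_restrict_add measurableE_ℰp K hS₀]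
  refine abs_integral_sub_le_of_const_close hg ?_ ?_ ?_ ?_ hWm hW1
  · rw [real_map_restrict_univ measurableE_ℰp, real_map_restrict_univ measurableE_ℰp,
      measureReal_add_measureReal_compl (μ := gibbsK F ℰp γ K) hS₀, probReal_univ]
  · rw [real_map_restrict_univ measurableE_ℰp, real_map_restrict_univ measurableE_ℰp,
      measureReal_add_measureReal_compl (μ := gibbsK F ℰp γ (K + 1)) hS₁, probReal_univ]
  · rw [real_map_restrict_univ measurableE_ℰp]; exact hw
  · rw [real_map_restrict_univ measurableE_ℰp]; exact hw'

end UnitLaws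

/-! ## §4 One step of the cascade: the chi-square clause of `HeightChiSqL` at cut-off `K` ⇒ the increment of the unit laws -/

section Step

variable (F : T3Family) {γ : ℝ}

/-- **THE GOOD PART OF A UNIT LAW, READ AT THE COMPARISON HEIGHT**: for `n ≤ K'`, a measurable event `S` of run `K'` and a measurable bounded
unit-lattice observable `W`: `∫ W d((A_{K'})_*(Gibbs_{K'}|S)) = ∫ (Z_{K'}⁻¹·ρ^S(V))·W(A_n V) dV` on `(F.P n)₀` — `A_{K'} = A_n ∘ D_{n,K'}`
(`unitA_comp_descendTo`) and the descended restricted law has the density `Z_{K'}⁻¹·heightDensity` (`map_descendTo_restrict_eq_withDensity`).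
[cite: Balaban1985UV3, (2) p.256 and (41) p.266] -/
theorem integral_map_unitA_restrict_eq (hγ : 0 ≤ γ) {n K' : ℕ} (hK' : n ≤ K')
    {S : Set (GaugeField (F.P K') 0 (Matrix.specialUnitaryGroup (Fin 2) ℂ))} (hS : MeasurableSet S)
    (W : GaugeField (F.P 0) 0 (Matrix.specialUnitaryGroup (Fin 2) ℂ) → ℝ) (hWm : Measurable W) :
    ∫ u, W u ∂Measure.map (unitA F ℰp K') ((gibbsK F ℰp γ K').restrict S) =
      ∫ V, ((partitionFn (G := Matrix.specialUnitaryGroup (Fin 2) ℂ) (F.P K') ((F.scheme ℰp γ).β K'))⁻¹ *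
          heightDensity F γ hK' S V) * W (unitA F ℰp n V)
        ∂fieldMeasure (F.P n) 0 (Matrix.specialUnitaryGroup (Fin 2) ℂ) := by
  set Z := partitionFn (G := Matrix.specialUnitaryGroup (Fin 2) ℂ) (F.P K') ((F.scheme ℰp γ).β K') with hZ
  have hZ0 : 0 < Z := partitionFn_pos' _ (F.scheme_β_nonneg ℰp hγ K')
  obtain ⟨hdm, -⟩ := heightDensity_props F hK' hS hγ
  have h0 : ∀ V, 0 ≤ Z⁻¹ * heightDensity F γ hK' S V :=
    fun V => mul_nonneg (inv_nonneg.mpr hZ0.le) (heightDensity_nonneg F γ hK' S V)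
  have hfm : Measurable fun V => ENNReal.ofReal (Z⁻¹ * heightDensity F γ hK' S V) :=
    ENNReal.measurable_ofReal.comp (hdm.const_mul _)
  rw [← unitA_comp_descendTo F ℰp hK', ← Measure.map_map (measurable_unitA F ℰp measurableE_ℰp n)
    (measurable_descendTo F ℰp measurableE_ℰp hK'), integral_map (measurable_unitA F ℰp measurableE_ℰp n).aemeasurable
    hWm.aestronglyMeasurable,
    map_descendTo_restrict_eq_withDensity F hK' hS hγ,
    integral_withDensity_eq_integral_toReal_smul hfm (ae_of_all _ fun V => ENNReal.ofReal_lt_top)]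
  refine integral_congr_ae (ae_of_all _ fun V => ?_)
  show (ENNReal.ofReal (Z⁻¹ * heightDensity F γ hK' S V)).toReal • W (unitA F ℰp n V) = _
  rw [ENNReal.toReal_ofReal (h0 V), smul_eq_mul]

/-- **ONE STEP OF THE CASCADE** (`γ ≥ 0`): at cut-off `K`, with `ρ⁰, ρ¹` the restricted densities of runs `K`, `K+1` on their UV-small-history
events descended to the comparison lattice `(F.P ⌊K/m⌋)₀` (`T3TiltDescent.heightDensity`), the clause of `HeightChiSqL` — `ρ⁰ = 0 ⇒ ρ¹ = 0` a.e.,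
`(ρ¹)²/ρ⁰` integrable, `(∫(ρ¹)²/ρ⁰)(∫ρ⁰) ≤ (1 + v)(∫ρ¹)²` — together with the large-field masses of both runs `≤ w` gives
`|∫ W dunitLaw(K+1) − ∫ W dunitLaw K| ≤ 2√v + 4w` for every measurable `|W| ≤ 1`: §1 gives `∫|ρ¹ − cρ⁰| ≤ √v·∫ρ¹`, §4's reading turns it into
closeness of the good unit laws up to the constant `c·Z_K/Z_{K+1}` with `t = √v·Gibbs_{K+1}(good) ≤ √v`, and §3 pays for the constant.
[cite: King1986, Thm 3.4 (3.9)-(3.10) p.656; Balaban1985UV3, (41) p.266] -/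
theorem abs_integral_unitLaw_succ_sub_le_of_chiSq (hγ : 0 ≤ γ) (b₀ p₀ : ℝ) (m K : ℕ) {v w : ℝ} (hv : 0 ≤ v)
    (hac : ∀ᵐ V ∂fieldMeasure (F.P (K / m)) 0 (Matrix.specialUnitaryGroup (Fin 2) ℂ),
      heightDensity F γ (Nat.div_le_self K m) (histGood F ℰp (θBal F.L γ b₀ p₀) K (K / m)) V = 0 →
        heightDensity F γ ((Nat.div_le_self K m).trans (Nat.le_succ K)) (histGood F ℰp (θBal F.L γ b₀ p₀) (K + 1) (K / m)) V = 0)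
    (hgi : Integrable (fun V =>
      heightDensity F γ ((Nat.div_le_self K m).trans (Nat.le_succ K)) (histGood F ℰp (θBal F.L γ b₀ p₀) (K + 1) (K / m)) V ^ 2 /
        heightDensity F γ (Nat.div_le_self K m) (histGood F ℰp (θBal F.L γ b₀ p₀) K (K / m)) V)
      (fieldMeasure (F.P (K / m)) 0 (Matrix.specialUnitaryGroup (Fin 2) ℂ)))
    (hchi : (∫ V, heightDensity F γ ((Nat.div_le_self K m).trans (Nat.le_succ K))
          (histGood F ℰp (θBal F.L γ b₀ p₀) (K + 1) (K / m)) V ^ 2 /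
        heightDensity F γ (Nat.div_le_self K m) (histGood F ℰp (θBal F.L γ b₀ p₀) K (K / m)) V
        ∂fieldMeasure (F.P (K / m)) 0 (Matrix.specialUnitaryGroup (Fin 2) ℂ)) *
      (∫ V, heightDensity F γ (Nat.div_le_self K m) (histGood F ℰp (θBal F.L γ b₀ p₀) K (K / m)) V
        ∂fieldMeasure (F.P (K / m)) 0 (Matrix.specialUnitaryGroup (Fin 2) ℂ)) ≤
      (1 + v) * (∫ V, heightDensity F γ ((Nat.div_le_self K m).trans (Nat.le_succ K))
        (histGood F ℰp (θBal F.L γ b₀ p₀) (K + 1) (K / m)) V ∂fieldMeasure (F.P (K / m)) 0 (Matrix.specialUnitaryGroup (Fin 2) ℂ)) ^ 2)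
    (hw : (gibbsK F ℰp γ K).real (histGood F ℰp (θBal F.L γ b₀ p₀) K (K / m))ᶜ ≤ w)
    (hw' : (gibbsK F ℰp γ (K + 1)).real (histGood F ℰp (θBal F.L γ b₀ p₀) (K + 1) (K / m))ᶜ ≤ w)
    {W : GaugeField (F.P 0) 0 (Matrix.specialUnitaryGroup (Fin 2) ℂ) → ℝ} (hWm : Measurable W) (hW1 : ∀ u, |W u| ≤ 1) :
    |(∫ u, W u ∂F.unitLaw ℰp measurableE_ℰp γ (K + 1)) - ∫ u, W u ∂F.unitLaw ℰp measurableE_ℰp γ K| ≤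
      2 * Real.sqrt v + 4 * w := by
  -- abbreviations
  set n := K / m with hn
  have h₀ : n ≤ K := Nat.div_le_self K m
  have h₁ : n ≤ K + 1 := (Nat.div_le_self K m).trans (Nat.le_succ K)
  set S₀ := histGood F ℰp (θBal F.L γ b₀ p₀) K n with hS₀
  set S₁ := histGood F ℰp (θBal F.L γ b₀ p₀) (K + 1) n with hS₁
  have hmS₀ : MeasurableSet S₀ := measurableSet_histGood F ℰp measurableE_ℰp _ K n
  have hmS₁ : MeasurableSet S₁ := measurableSet_histGood F ℰp measurableE_ℰp _ (K + 1) n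
  set lam := fieldMeasure (F.P n) 0 (Matrix.specialUnitaryGroup (Fin 2) ℂ) with hlam
  set ρ₀ := heightDensity F γ h₀ S₀ with hρ₀
  set ρ₁ := heightDensity F γ h₁ S₁ with hρ₁
  obtain ⟨hρ₀m, hρ₀i⟩ := heightDensity_props F h₀ hmS₀ hγ
  obtain ⟨hρ₁m, hρ₁i⟩ := heightDensity_props F h₁ hmS₁ hγ
  have hρ₀0 : ∀ V, 0 ≤ ρ₀ V := heightDensity_nonneg F γ h₀ S₀
  have hρ₁0 : ∀ V, 0 ≤ ρ₁ V := heightDensity_nonneg F γ h₁ S₁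
  -- §1: `∫ |ρ¹ − c ρ⁰| ≤ √v ∫ ρ¹`
  obtain ⟨c, -, hL1⟩ := exists_integral_abs_sub_const_mul_le lam hρ₀0 hρ₁0 hρ₀i hρ₁i hac hgi hv hchi
  -- the two normalisations
  set Z₀ := partitionFn (G := Matrix.specialUnitaryGroup (Fin 2) ℂ) (F.P K) ((F.scheme ℰp γ).β K) with hZ₀
  set Z₁ := partitionFn (G := Matrix.specialUnitaryGroup (Fin 2) ℂ) (F.P (K + 1)) ((F.scheme ℰp γ).β (K + 1)) with hZ₁
  have hZ₀0 : 0 < Z₀ := partitionFn_pos' _ (F.scheme_β_nonneg ℰp hγ K)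
  have hZ₁0 : 0 < Z₁ := partitionFn_pos' _ (F.scheme_β_nonneg ℰp hγ (K + 1))
  -- the total good mass of run `K+1`: `∫ Z₁⁻¹ρ¹ = Gibbs_{K+1}(S₁) ≤ 1`
  haveI := isProbabilityMeasure_gibbsK F ℰp hγ (K + 1)
  have hmass : ∫ V, Z₁⁻¹ * ρ₁ V ∂lam ≤ 1 := by
    have h := integral_map_unitA_restrict_eq F hγ h₁ hmS₁ (fun _ => (1 : ℝ)) measurable_const
    simp only [mul_one, integral_const, smul_eq_mul] at h
    rw [real_map_restrict_univ measurableE_ℰp] at h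
    rw [← h]
    exact measureReal_le_one
  -- §3 with the constant `c·Z₀/Z₁` and `t = √v`
  refine (abs_integral_unitLaw_succ_sub_le_of_const_close F hγ (θBal F.L γ b₀ p₀) n K (c := c * Z₀ * Z₁⁻¹)
    (t := Real.sqrt v) (fun W' hW'm hW'1 => ?_) hw hw' hWm hW1).trans (le_of_eq (by ring))
  rw [integral_map_unitA_restrict_eq F hγ h₁ hmS₁ W' hW'm, integral_map_unitA_restrict_eq F hγ h₀ hmS₀ W' hW'm,
    ← integral_const_mul]
  have hWA : AEStronglyMeasurable (fun V => W' (unitA F ℰp n V)) lam :=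
    (hW'm.comp (measurable_unitA F ℰp measurableE_ℰp n)).aestronglyMeasurable
  have hWb : ∀ᵐ V ∂lam, ‖W' (unitA F ℰp n V)‖ ≤ 1 := ae_of_all _ fun V => by rw [Real.norm_eq_abs]; exact hW'1 _
  have hi₁ : Integrable (fun V => (Z₁⁻¹ * ρ₁ V) * W' (unitA F ℰp n V)) lam := (hρ₁i.const_mul _).mul_bdd hWA hWb
  have hi₀ : Integrable (fun V => (c * Z₀ * Z₁⁻¹) * ((Z₀⁻¹ * ρ₀ V) * W' (unitA F ℰp n V))) lam :=
    ((hρ₀i.const_mul _).mul_bdd hWA hWb).const_mul _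
  rw [← integral_sub hi₁ hi₀]
  have hZ₀' := hZ₀0.ne'
  have hZ₁' := hZ₁0.ne'
  have hpt : ∀ V, (Z₁⁻¹ * ρ₁ V) * W' (unitA F ℰp n V) - (c * Z₀ * Z₁⁻¹) * ((Z₀⁻¹ * ρ₀ V) * W' (unitA F ℰp n V)) =
      Z₁⁻¹ * ((ρ₁ V - c * ρ₀ V) * W' (unitA F ℰp n V)) := by
    intro V
    field_simp
  rw [integral_congr_ae (ae_of_all _ hpt), integral_const_mul]
  have hdi : Integrable (fun V => (ρ₁ V - c * ρ₀ V) * W' (unitA F ℰp n V)) lam :=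
    (hρ₁i.sub (hρ₀i.const_mul c)).mul_bdd hWA hWb
  have hai : Integrable (fun V => |ρ₁ V - c * ρ₀ V|) lam := (hρ₁i.sub (hρ₀i.const_mul c)).abs
  have hptabs : ∀ V, |(ρ₁ V - c * ρ₀ V) * W' (unitA F ℰp n V)| ≤ |ρ₁ V - c * ρ₀ V| := fun V => by
    rw [abs_mul]
    exact mul_le_of_le_one_right (abs_nonneg _) (hW'1 _)
  calc |Z₁⁻¹ * ∫ V, (ρ₁ V - c * ρ₀ V) * W' (unitA F ℰp n V) ∂lam|
      = Z₁⁻¹ * |∫ V, (ρ₁ V - c * ρ₀ V) * W' (unitA F ℰp n V) ∂lam| := by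
        rw [abs_mul, abs_of_pos (inv_pos.mpr hZ₁0)]
    _ ≤ Z₁⁻¹ * ∫ V, |(ρ₁ V - c * ρ₀ V) * W' (unitA F ℰp n V)| ∂lam :=
        mul_le_mul_of_nonneg_left abs_integral_le_integral_abs (inv_nonneg.mpr hZ₁0.le)
    _ ≤ Z₁⁻¹ * ∫ V, |ρ₁ V - c * ρ₀ V| ∂lam :=
        mul_le_mul_of_nonneg_left (integral_mono hdi.abs hai hptabs) (inv_nonneg.mpr hZ₁0.le)
    _ ≤ Z₁⁻¹ * (Real.sqrt v * ∫ V, ρ₁ V ∂lam) := mul_le_mul_of_nonneg_left hL1 (inv_nonneg.mpr hZ₁0.le)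
    _ = Real.sqrt v * ∫ V, Z₁⁻¹ * ρ₁ V ∂lam := by rw [integral_const_mul]; ring
    _ ≤ Real.sqrt v * 1 := mul_le_mul_of_nonneg_left hmass (Real.sqrt_nonneg _)
    _ = Real.sqrt v := mul_one _

end Step

end Summit.QuantumFields.YangMills.Theorems.LeafOfChiSq

end
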